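import Mathlib
import Literature.NumberTheory.LFunctions.Zhang2022.Section8Step8u012
import HarnessLib

/-!
# Zhang (2022) §8 p. 43, step `Z22:§8.u012` from Lemma 5.9 ON ITS USE-RANGE and Proposition 2.2 (i)
# (the inputs the WINDOWED Proposition 2.2 supplies)

Topic `Literature/NumberTheory/LFunctions/Zhang2022` (Landau–Siegel audit tree; verdict-neutral;
D-0069 campaign node **Z22:§8.u012**, locator [Z22 p.43, §8 proof of Lemma 8.1, tex L2240–L2243];
typed claim `Section8aStatements.Step8u012 c′`; leaf `Step8u012` of `theorem1_of_leaves_v12`).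
Y. Zhang, *Discrete mean estimates and the Landau–Siegel zero*, arXiv:2211.02515v1 (2022)
[Zhang2022LandauSiegel] — **an unrefereed manuscript under adjudication**.

sz-d14's kernel edge `Section8aStatements.step8u012_of_prop22 : 0 ≤ c′ → Skeleton.Prop22 c′ →
Step8u012 c′` (`Section8Step8u012`) uses Proposition 2.2 in exactly two ways: (i) "the zeros in `Ω`
are on the line" (clearance `|s − ρ| ≥ α` on `𝔍(α)`), and Lemma 5.9 on the height range
`|t − 2πt₀| ≤ 𝓛₁ + 1/4` (`Skeleton.lemma59_restricted_of_prop22`). This file re-runs that proof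
VERBATIM with those two inputs as hypotheses —
`Section8aStatements.step8u012_of_lemma59R : 0 ≤ c′ → (Lemma 5.9 on 𝓛₁ + 1/4) → Prop22i →
Step8u012 c′` — so that the step is also available from the WINDOWED node of record
`Skeleton.Prop22W c′` (whose (iii) is weaker than `Prop22iii`), via sz-d02's
`Skeleton.lemma59_restricted_of_prop22W` (`Section5Lemma59Window`); the one-line corollary
`step8u012_of_prop22W` is in `Section8Ded81VClosed`. No new definition, no named fact. Adapted from
`Section8Step8u012.lean` (sz-d14) with attribution; the mathematics is the printed step "By Lemma 5.2
and 5.9, `Ĩ₁⁺ − I₁⁺ ≪ 𝓛⁻¹¹⁴∫_{𝔍(α)}|L(s+β₂,ψ)L(s+β₃,ψ)A A ω ds|`".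

WHAT THIS IS NOT: any statement about Theorems 1–2 of the manuscript or about Landau–Siegel
zeros; Proposition 2.2 (i) and Lemma 5.9 stay hypotheses here.

## References

* Y. Zhang, arXiv:2211.02515v1 (2022), §8 p.43 tex L2236–L2243; (7.1); Lemmas 5.2, 5.9;
  Proposition 2.2. [cite: Zhang2022LandauSiegel, §8 p.43]
-/

noncomputable section

open Complex Real Set MeasureTheory intervalIntegral

namespace Literature.NumberTheory.LFunctions.Zhang2022

namespace Section8aStatements

open Skeleton Step8u012Holds GammaFactor

/-- **`Z22:§8.u012` from Lemma 5.9 on its use-range and Proposition 2.2 (i)** ([Z22 p.43, tex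
L2240–L2243]): for every `c′ ≥ 0`, if Lemma 5.9 holds on `|t − 2πt₀| ≤ 𝓛₁ + 1/4` (every `c₀ > 0` gets
its `C`) and the zeros of `L(s,ψ)L(s,ψχ)` in `Ω` lie on the line (`Prop22i`), then `Step8u012 c′`:
`|Ĩ₁⁺(𝐚₁,𝐚₂;ψ) − I₁⁺(𝐚₁,𝐚₂;ψ)| ≤ C𝓛⁻¹¹⁴∫_{−𝓛₁}^{𝓛₁}|L(s+β₂,ψ)L(s+β₃,ψ)A(𝐚₁;s,ψ)A(𝐚₂,1−s,ψ̄)ω(s)| dv`,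
`s = α + s₀ + iv`, with `C = C₅₂e¹¹C₅₉/(2π)` (Lemma 5.2 = tree theorem `Skeleton.lemma52_holds`).
sz-d14's `step8u012_of_prop22` verbatim with its two Prop-2.2 inputs as hypotheses.
[cite: Zhang2022LandauSiegel, §8 p.43, tex L2240–L2243] -/
theorem step8u012_of_lemma59R {c' : ℝ} (hc' : 0 ≤ c')
    (h59R : ∀ c₀ : ℝ, 0 < c₀ → ∃ C : ℝ, ForAllLarge fun D _ χ => ∀ x ∈ PsiOne χ, ∀ s : ℂ,
      |s.re - 1 / 2| ≤ alpha D → |s.im - 2 * π * t0 D| ≤ ell1 D + 1 / 4 →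
        (∀ ρ : ℂ, x.ψ.LFunction ρ = 0 → c₀ * alpha D ≤ ‖s - ρ‖) →
          ‖x.ψ.LFunction (s + beta1 c' D) / x.ψ.LFunction s‖ ≤ C * Real.log (bigP D))
    (h22i : Prop22i) : Step8u012 c' := by
  -- adapted from Section8Step8u012.lean (sz-d14), `step8u012_of_prop22`
  intro B
  obtain ⟨C₂, D₂, h52⟩ := lemma52_holds c'
  obtain ⟨C₉, D₉, h59⟩ := h59R 1 one_pos
  obtain ⟨D₁, hi⟩ := h22i
  set K : ℝ := max C₂ 0 * Real.exp 11 * max C₉ 0 with hKdef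
  have hK0 : 0 ≤ K := by rw [hKdef]; positivity
  refine ⟨K / (2 * Real.pi), max (max D₁ (max D₂ D₉)) ⌈Real.exp (32 + 40 * c')⌉₊,
    fun D _ χ hD hq hp _hA a₁ a₂ _ha₁ _ha₂ x hx => ?_⟩
  -- thresholds
  have hD₁ : D₁ ≤ D := le_trans (le_trans (le_max_left _ _) (le_max_left _ _)) hD
  have hD₂ : D₂ ≤ D :=
    le_trans (le_trans (le_trans (le_max_left _ _) (le_max_right _ _)) (le_max_left _ _)) hD
  have hD₉ : D₉ ≤ D :=
    le_trans (le_trans (le_trans (le_max_right _ _) (le_max_right _ _)) (le_max_left _ _)) hD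
  have hDceil : ⌈Real.exp (32 + 40 * c')⌉₊ ≤ D := le_trans (le_max_right _ _) hD
  have hexp : Real.exp (32 + 40 * c') ≤ D := le_trans (Nat.le_ceil _) (by exact_mod_cast hDceil)
  have hD0 : (0 : ℝ) < D := lt_of_lt_of_le (Real.exp_pos _) hexp
  have hLc : 32 + 40 * c' ≤ ell D := (Real.le_log_iff_exp_le hD0).mpr hexp
  have hL : 32 ≤ ell D := by linarith
  have hL1 : 1 ≤ ell D := by linarith
  have hLne0 : ell D ≠ 0 := by linarith
  obtain ⟨hα0, hα100, hb1, hb2, hb3, ht0pos⟩ := scales8 hc' hLc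
  have hα4 : alpha D ≤ 1 / 4 := by linarith
  have hlogP : Real.log (bigP D) = ell D ^ 9 := by rw [bigP, Real.log_exp]
  have hix := hi D χ hD₁ hq hp x hx
  have h52x := h52 D χ hD₂ hq hp x
  have h59x := h59 D χ hD₉ hq hp x hx
  -- the points `s = α + s₀ + iv` of `𝔍(α)` and the data there
  have hsv_re : ∀ v : ℝ, ((alpha D : ℂ) + s0 D + v * I).re = 1 / 2 + alpha D := fun v => by
    simp [s0, SmoothWeight.s0_def]; ring
  have hsv_im : ∀ v : ℝ, ((alpha D : ℂ) + s0 D + v * I).im = 2 * π * t0 D + v := fun v => by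
    simp [s0, SmoothWeight.s0_def]
  have hfar : ∀ v : ℝ, |v| ≤ ell1 D → ∀ ρ : ℂ, x.ψ.LFunction ρ = 0 →
      1 * alpha D ≤ ‖((alpha D : ℂ) + s0 D + v * I) - ρ‖ := by
    intro v hv ρ hρ
    rw [one_mul]
    exact alpha_le_norm_sub_of_prop22i χ x hα0.le hα4 hix (hsv_re v)
      (by rw [hsv_im, show 2 * π * t0 D + v - 2 * π * t0 D = v by ring]; exact hv) ρ hρ
  have hLne : ∀ v ∈ Icc (-ell1 D) (ell1 D), x.ψ.LFunction ((alpha D : ℂ) + s0 D + v * I) ≠ 0 := by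
    intro v hv h0
    have h := hfar v (abs_le.mpr ⟨hv.1, hv.2⟩) _ h0
    rw [sub_self, norm_zero] at h
    linarith
  -- pointwise: `‖𝒞̃AAω − 𝒞AAω‖ ≤ K𝓛⁻¹¹⁴‖L(s+β₂)L(s+β₃)AAω‖`
  have hpt : ∀ v ∈ Icc (-ell1 D) (ell1 D),
      ‖integrandTilde c' x a₁ a₂ ((alpha D : ℂ) + s0 D + v * I) -
          integrandC c' x a₁ a₂ ((alpha D : ℂ) + s0 D + v * I)‖ ≤
        K * (ell D ^ 114)⁻¹ *
          ‖x.ψ.LFunction ((alpha D : ℂ) + s0 D + v * I + beta2 c' D) *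
              x.ψ.LFunction ((alpha D : ℂ) + s0 D + v * I + beta3 c' D) *
            Apoly x a₁ ((alpha D : ℂ) + s0 D + v * I) *
              ApolyBar x a₂ (1 - ((alpha D : ℂ) + s0 D + v * I)) *
            omegaW D ((alpha D : ℂ) + s0 D + v * I)‖ := by
    intro v hv
    have hvabs : |v| ≤ ell1 D := abs_le.mpr ⟨hv.1, hv.2⟩
    have hIn : InRange51 D ((alpha D : ℂ) + s0 D + v * I) := by
      refine ⟨?_, ?_⟩
      · rw [hsv_re, show (1 : ℝ) / 2 + alpha D - 1 / 2 = alpha D by ring, abs_of_pos hα0]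
      · rw [hsv_im, show 2 * π * t0 D + v - 2 * π * t0 D = v by ring]; linarith
    -- Lemma 5.2 at `s`
    have h2 := h52x ((alpha D : ℂ) + s0 D + v * I) hIn
    -- Lemma 5.9 at `s`
    have h9 := h59x ((alpha D : ℂ) + s0 D + v * I)
      (by rw [hsv_re, show (1 : ℝ) / 2 + alpha D - 1 / 2 = alpha D by ring, abs_of_pos hα0])
      (by rw [hsv_im, show 2 * π * t0 D + v - 2 * π * t0 D = v by ring]; linarith) (hfar v hvabs)
    have hL0pos : 0 < ‖x.ψ.LFunction ((alpha D : ℂ) + s0 D + v * I)‖ :=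
      norm_pos_iff.mpr (hLne v hv)
    rw [norm_div, div_le_iff₀ hL0pos] at h9
    -- the size of `(pt₀)^{β₃}Z⁻¹`
    have hZ := norm_coeff_Zinv_le (c' := c') hL hα0 hα100 x hvabs
    -- the two factors
    have hYq_le : ‖Yroot x.ψ ((alpha D : ℂ) + s0 D + v * I + beta1 c' D) *
            Yroot x.ψ ((alpha D : ℂ) + s0 D + v * I + beta2 c' D) *
            Yroot x.ψ ((alpha D : ℂ) + s0 D + v * I + beta3 c' D) /
            Yroot x.ψ ((alpha D : ℂ) + s0 D + v * I) -
          (((x.p : ℝ) * t0 D : ℝ) : ℂ) ^ beta3 c' D *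
            (Zfac x.ψ ((alpha D : ℂ) + s0 D + v * I))⁻¹‖ ≤
        max C₂ 0 * (ell D ^ 123)⁻¹ * Real.exp 11 := by
      refine h2.trans ?_
      calc C₂ * (ell D ^ 123)⁻¹ *
            ‖(((x.p : ℝ) * t0 D : ℝ) : ℂ) ^ beta3 c' D * (Zfac x.ψ ((alpha D : ℂ) + s0 D + v * I))⁻¹‖
          ≤ max C₂ 0 * (ell D ^ 123)⁻¹ *
            ‖(((x.p : ℝ) * t0 D : ℝ) : ℂ) ^ beta3 c' D *
              (Zfac x.ψ ((alpha D : ℂ) + s0 D + v * I))⁻¹‖ := by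
            gcongr; exact le_max_left _ _
        _ ≤ max C₂ 0 * (ell D ^ 123)⁻¹ * Real.exp 11 := by gcongr
    have hratio : ‖x.ψ.LFunction ((alpha D : ℂ) + s0 D + v * I + beta1 c' D) /
          x.ψ.LFunction ((alpha D : ℂ) + s0 D + v * I)‖ ≤ max C₉ 0 * ell D ^ 9 := by
      rw [norm_div, div_le_iff₀ hL0pos, ← hlogP]
      refine h9.trans ?_
      have hlog0 : 0 ≤ Real.log (bigP D) := by rw [hlogP]; positivity
      exact mul_le_mul_of_nonneg_right
        (mul_le_mul_of_nonneg_right (le_max_left _ _) hlog0) (norm_nonneg _)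
    have hprod : ‖Yroot x.ψ ((alpha D : ℂ) + s0 D + v * I + beta1 c' D) *
            Yroot x.ψ ((alpha D : ℂ) + s0 D + v * I + beta2 c' D) *
            Yroot x.ψ ((alpha D : ℂ) + s0 D + v * I + beta3 c' D) /
            Yroot x.ψ ((alpha D : ℂ) + s0 D + v * I) -
          (((x.p : ℝ) * t0 D : ℝ) : ℂ) ^ beta3 c' D *
            (Zfac x.ψ ((alpha D : ℂ) + s0 D + v * I))⁻¹‖ *
        ‖x.ψ.LFunction ((alpha D : ℂ) + s0 D + v * I + beta1 c' D) /
          x.ψ.LFunction ((alpha D : ℂ) + s0 D + v * I)‖ ≤ K * (ell D ^ 114)⁻¹ := by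
      refine (mul_le_mul hYq_le hratio (norm_nonneg _) (by positivity)).trans (le_of_eq ?_)
      rw [hKdef]
      field_simp
    rw [integrandTilde_sub_integrandC]
    have e : x.ψ.LFunction ((alpha D : ℂ) + s0 D + v * I + beta2 c' D) *
          x.ψ.LFunction ((alpha D : ℂ) + s0 D + v * I + beta3 c' D) *
        (Apoly x a₁ ((alpha D : ℂ) + s0 D + v * I) *
          ApolyBar x a₂ (1 - ((alpha D : ℂ) + s0 D + v * I)) *
          omegaW D ((alpha D : ℂ) + s0 D + v * I)) =
        x.ψ.LFunction ((alpha D : ℂ) + s0 D + v * I + beta2 c' D) *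
            x.ψ.LFunction ((alpha D : ℂ) + s0 D + v * I + beta3 c' D) *
          Apoly x a₁ ((alpha D : ℂ) + s0 D + v * I) *
            ApolyBar x a₂ (1 - ((alpha D : ℂ) + s0 D + v * I)) *
          omegaW D ((alpha D : ℂ) + s0 D + v * I) := by ring
    rw [← e]
    calc ‖-I *
          (Yroot x.ψ ((alpha D : ℂ) + s0 D + v * I + beta1 c' D) *
                Yroot x.ψ ((alpha D : ℂ) + s0 D + v * I + beta2 c' D) *
                Yroot x.ψ ((alpha D : ℂ) + s0 D + v * I + beta3 c' D) /
                Yroot x.ψ ((alpha D : ℂ) + s0 D + v * I) -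
              (((x.p : ℝ) * t0 D : ℝ) : ℂ) ^ beta3 c' D *
                (Zfac x.ψ ((alpha D : ℂ) + s0 D + v * I))⁻¹) *
          (x.ψ.LFunction ((alpha D : ℂ) + s0 D + v * I + beta1 c' D) /
            x.ψ.LFunction ((alpha D : ℂ) + s0 D + v * I)) *
          (x.ψ.LFunction ((alpha D : ℂ) + s0 D + v * I + beta2 c' D) *
            x.ψ.LFunction ((alpha D : ℂ) + s0 D + v * I + beta3 c' D)) *
          (Apoly x a₁ ((alpha D : ℂ) + s0 D + v * I) *
            ApolyBar x a₂ (1 - ((alpha D : ℂ) + s0 D + v * I)) *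
            omegaW D ((alpha D : ℂ) + s0 D + v * I))‖
        = ‖Yroot x.ψ ((alpha D : ℂ) + s0 D + v * I + beta1 c' D) *
                Yroot x.ψ ((alpha D : ℂ) + s0 D + v * I + beta2 c' D) *
                Yroot x.ψ ((alpha D : ℂ) + s0 D + v * I + beta3 c' D) /
                Yroot x.ψ ((alpha D : ℂ) + s0 D + v * I) -
              (((x.p : ℝ) * t0 D : ℝ) : ℂ) ^ beta3 c' D *
                (Zfac x.ψ ((alpha D : ℂ) + s0 D + v * I))⁻¹‖ *
            ‖x.ψ.LFunction ((alpha D : ℂ) + s0 D + v * I + beta1 c' D) /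
              x.ψ.LFunction ((alpha D : ℂ) + s0 D + v * I)‖ *
            ‖x.ψ.LFunction ((alpha D : ℂ) + s0 D + v * I + beta2 c' D) *
                x.ψ.LFunction ((alpha D : ℂ) + s0 D + v * I + beta3 c' D) *
              (Apoly x a₁ ((alpha D : ℂ) + s0 D + v * I) *
                ApolyBar x a₂ (1 - ((alpha D : ℂ) + s0 D + v * I)) *
                omegaW D ((alpha D : ℂ) + s0 D + v * I))‖ := by
          simp only [norm_mul, norm_neg, Complex.norm_I, one_mul]
          ring
      _ ≤ K * (ell D ^ 114)⁻¹ *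
            ‖x.ψ.LFunction ((alpha D : ℂ) + s0 D + v * I + beta2 c' D) *
                x.ψ.LFunction ((alpha D : ℂ) + s0 D + v * I + beta3 c' D) *
              (Apoly x a₁ ((alpha D : ℂ) + s0 D + v * I) *
                ApolyBar x a₂ (1 - ((alpha D : ℂ) + s0 D + v * I)) *
                omegaW D ((alpha D : ℂ) + s0 D + v * I))‖ :=
          mul_le_mul_of_nonneg_right hprod (norm_nonneg _)
  -- integrability along `𝔍(α)`
  have hℓ0 : (0 : ℝ) ≤ ell1 D := by rw [ell1]; positivity
  have hℓ : (-ell1 D) ≤ ell1 D := by linarith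
  have huIcc : Set.uIcc (-ell1 D) (ell1 D) = Icc (-ell1 D) (ell1 D) := Set.uIcc_of_le hℓ
  have hcontT : ContinuousOn (fun v : ℝ => integrandTilde c' x a₁ a₂ ((alpha D : ℂ) + s0 D + v * I))
      (Icc (-ell1 D) (ell1 D)) :=
    continuousOn_integrandTilde_J x hL1 hb1 hb2 hb3 a₁ a₂ Subset.rfl hLne
  have hcontC : ContinuousOn (fun v : ℝ => integrandC c' x a₁ a₂ ((alpha D : ℂ) + s0 D + v * I))
      (Icc (-ell1 D) (ell1 D)) :=
    continuousOn_integrandC_J x hL1 a₁ a₂ Subset.rfl hLne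
  have hIT : IntervalIntegrable (fun v : ℝ => integrandTilde c' x a₁ a₂ ((alpha D : ℂ) + s0 D + v * I))
      volume (-ell1 D) (ell1 D) :=
    (hcontT.mono (by rw [huIcc])).intervalIntegrable
  have hIC : IntervalIntegrable (fun v : ℝ => integrandC c' x a₁ a₂ ((alpha D : ℂ) + s0 D + v * I))
      volume (-ell1 D) (ell1 D) :=
    (hcontC.mono (by rw [huIcc])).intervalIntegrable
  -- the majorant is continuous (a product of continuous functions)
  have hsvc := continuous_sv D
  have hLc : Continuous x.ψ.LFunction := Ded81Edge.continuous_LFunction_chr x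
  have hmaj : Continuous fun v : ℝ =>
      ‖x.ψ.LFunction ((alpha D : ℂ) + s0 D + v * I + beta2 c' D) *
          x.ψ.LFunction ((alpha D : ℂ) + s0 D + v * I + beta3 c' D) *
        Apoly x a₁ ((alpha D : ℂ) + s0 D + v * I) *
          ApolyBar x a₂ (1 - ((alpha D : ℂ) + s0 D + v * I)) *
        omegaW D ((alpha D : ℂ) + s0 D + v * I)‖ := by
    refine Continuous.norm ?_
    refine Continuous.mul (Continuous.mul (Continuous.mul (Continuous.mul ?_ ?_) ?_) ?_) ?_
    · exact hLc.comp (hsvc.add continuous_const)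
    · exact hLc.comp (hsvc.add continuous_const)
    · exact (Ded81Edge.continuous_dirPoly (Nsupp D) a₁ x.ψ x.p_ne_one).comp hsvc
    · exact (Ded81Edge.continuous_dirPoly (Nsupp D) a₂ x.ψ⁻¹ x.p_ne_one).comp
        (continuous_const.sub hsvc)
    · exact (Ded81Edge.continuous_omega (ell2 D) (t0 D)).comp hsvc
  -- the difference of the two segment integrals
  have hs0 : SmoothWeight.s0 (t0 D) = s0 D := rfl
  have hdiff : Itil c' x (alpha D) a₁ a₂ - IonePlus c' x a₁ a₂ =
      (1 / (2 * π) : ℂ) * ∫ v in (-ell1 D)..ell1 D,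
        (integrandTilde c' x a₁ a₂ ((alpha D : ℂ) + s0 D + v * I) -
          integrandC c' x a₁ a₂ ((alpha D : ℂ) + s0 D + v * I)) := by
    rw [Itil, IonePlus, Lemma81.segInt_def, Lemma81.segInt_def, hs0, ← mul_sub,
      ← intervalIntegral.integral_sub hIT hIC]
  rw [hdiff, norm_mul]
  have hnorm2π : ‖(1 / (2 * π) : ℂ)‖ = 1 / (2 * π) := by
    rw [show (1 / (2 * π) : ℂ) = ((1 / (2 * π) : ℝ) : ℂ) by push_cast; ring, Complex.norm_real,
      Real.norm_eq_abs, abs_of_pos (by positivity)]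
  rw [hnorm2π]
  have hint : ‖∫ v in (-ell1 D)..ell1 D,
        (integrandTilde c' x a₁ a₂ ((alpha D : ℂ) + s0 D + v * I) -
          integrandC c' x a₁ a₂ ((alpha D : ℂ) + s0 D + v * I))‖
      ≤ ∫ v in (-ell1 D)..ell1 D, K * (ell D ^ 114)⁻¹ *
          ‖x.ψ.LFunction ((alpha D : ℂ) + s0 D + v * I + beta2 c' D) *
              x.ψ.LFunction ((alpha D : ℂ) + s0 D + v * I + beta3 c' D) *
            Apoly x a₁ ((alpha D : ℂ) + s0 D + v * I) *
              ApolyBar x a₂ (1 - ((alpha D : ℂ) + s0 D + v * I)) *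
            omegaW D ((alpha D : ℂ) + s0 D + v * I)‖ := by
    refine (intervalIntegral.norm_integral_le_integral_norm hℓ).trans ?_
    exact intervalIntegral.integral_mono_on hℓ (hIT.sub hIC).norm
      ((hmaj.const_mul _).intervalIntegrable _ _) fun v hv => hpt v hv
  rw [intervalIntegral.integral_const_mul] at hint
  have h2π : (0 : ℝ) ≤ 1 / (2 * π) := by positivity
  calc 1 / (2 * π) * ‖∫ v in (-ell1 D)..ell1 D,
          (integrandTilde c' x a₁ a₂ ((alpha D : ℂ) + s0 D + v * I) -
            integrandC c' x a₁ a₂ ((alpha D : ℂ) + s0 D + v * I))‖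
      ≤ 1 / (2 * π) * (K * (ell D ^ 114)⁻¹ * ∫ v in (-ell1 D)..ell1 D,
          ‖x.ψ.LFunction ((alpha D : ℂ) + s0 D + v * I + beta2 c' D) *
              x.ψ.LFunction ((alpha D : ℂ) + s0 D + v * I + beta3 c' D) *
            Apoly x a₁ ((alpha D : ℂ) + s0 D + v * I) *
              ApolyBar x a₂ (1 - ((alpha D : ℂ) + s0 D + v * I)) *
            omegaW D ((alpha D : ℂ) + s0 D + v * I)‖) :=
        mul_le_mul_of_nonneg_left hint h2π
    _ = K / (2 * π) * (ell D ^ 114)⁻¹ * ∫ v in (-ell1 D)..ell1 D,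
          ‖x.ψ.LFunction ((alpha D : ℂ) + s0 D + v * I + beta2 c' D) *
              x.ψ.LFunction ((alpha D : ℂ) + s0 D + v * I + beta3 c' D) *
            Apoly x a₁ ((alpha D : ℂ) + s0 D + v * I) *
              ApolyBar x a₂ (1 - ((alpha D : ℂ) + s0 D + v * I)) *
            omegaW D ((alpha D : ℂ) + s0 D + v * I)‖ := by ring

end Section8aStatements

end Literature.NumberTheory.LFunctions.Zhang2022
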